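import Mathlib.Analysis.Calculus.UniformLimitsDeriv
import Mathlib.Analysis.Calculus.ContDiff.Basic
import Mathlib.Algebra.Order.Field.GeomSum
import Mathlib.Analysis.SpecificLimits.Basic
import HarnessLib

/-!
# `C^N` functions are closed under uniform convergence of the derivatives of order `≤ N`

Analysis/Calculus support file (everything proved). Mathlib (at the pin of this tree) passes
**one** derivative to a uniform limit (`hasFDerivAt_of_tendstoUniformlyOn`); this file iterates
it along the Taylor fields: if `f n` are `C^N` on an open set `U` of a real normed space, the
iterated derivatives `D^m (f n)`, `m ≤ N`, converge uniformly on `U` to fields `p m`, and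
`f n → g` pointwise on `U`, then `g` admits `p` as a Taylor series up to order `N` on `U`
(`hasFTaylorSeriesUpToOn_of_tendstoUniformlyOn`); hence `g` is `C^N` on `U`
(`contDiffOn_of_tendstoUniformlyOn_iteratedFDeriv`), `D^m g = p m = lim D^m (f n)` on `U`
(`iteratedFDeriv_eq_of_tendstoUniformlyOn`,
`tendstoUniformlyOn_iteratedFDeriv_of_tendstoUniformlyOn`), and uniform bounds
`‖D^m (f n) x‖ ≤ C` pass to the limit (`norm_iteratedFDeriv_le_of_tendstoUniformlyOn`). A
**Cauchy form** for complete targets (`exists_tendstoUniformlyOn_of_uniformCauchySeqOn_iteratedFDeriv`)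
produces the limit fields from uniformly Cauchy derivatives. This is the real-variable companion of
the tree's `Literature/Analysis/Complex/LocallyUniformLimitSCV.lean` (holomorphic case) and is the
form in which fixed points of Picard iterations carrying `C^N` bounds are shown to be `C^N`
(e.g. Koch–Nadirashvili–Seregin–Šverák 2009, Prop. 4.1: smoothing of bounded mild solutions).

## Mathlib search

`hasFDerivAt_of_tendstoUniformlyOn`, `hasFDerivAt_of_tendstoLocallyUniformlyOn`,
`TendstoUniformlyOn.continuousOn`, `UniformCauchySeqOn.tendstoUniformlyOn_of_tendsto`,
`HasFTaylorSeriesUpToOn.contDiffOn`, `ContDiffOn.ftaylorSeriesWithin`; no `ContDiff` statement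
for limits of sequences (searched `contDiff.*tendsto`, `iteratedFDeriv.*Uniform`: none).

## References

* J. Dieudonné, *Foundations of Modern Analysis* (1960), (8.6.3)–(8.6.4) (limits of derivatives)
  and (8.12) (higher derivatives).
* H. Cartan, *Calcul différentiel* (1967), Thm. 3.6.2.
-/

noncomputable section

open Set Filter Function Metric
open scoped Topology ContDiff

namespace Literature.Analysis.Calculus

variable {P : Type*} [NormedAddCommGroup P] [NormedSpace ℝ P]
  {G : Type*} [NormedAddCommGroup G] [NormedSpace ℝ G]
  {ι : Type*} {l : Filter ι}

/-- On an open set the iterated derivative within the set of a `C^N` function has the next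
iterated derivative (curried) as its Fréchet derivative. [folklore] -/
theorem hasFDerivAt_iteratedFDeriv_of_contDiffOn {U : Set P} (hU : IsOpen U) {N : ℕ∞} {f : P → G}
    (hf : ContDiffOn ℝ N f U) {m : ℕ} (hm : (m : ℕ∞) < N) {x : P} (hx : x ∈ U) :
    HasFDerivAt (iteratedFDeriv ℝ m f) (iteratedFDeriv ℝ (m + 1) f x).curryLeft x := by
  have hT := hf.ftaylorSeriesWithin hU.uniqueDiffOn
  have h1 : HasFDerivWithinAt (fun y => iteratedFDerivWithin ℝ m f U y)
      (iteratedFDerivWithin ℝ (m + 1) f U x).curryLeft U x :=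
    hT.fderivWithin m (by exact_mod_cast hm) x hx
  have h2 : HasFDerivAt (fun y => iteratedFDerivWithin ℝ m f U y)
      (iteratedFDerivWithin ℝ (m + 1) f U x).curryLeft x :=
    h1.hasFDerivAt (hU.mem_nhds hx)
  rw [iteratedFDerivWithin_of_isOpen (m + 1) hU hx] at h2
  refine h2.congr_of_eventuallyEq ?_
  filter_upwards [hU.mem_nhds hx] with y hy
  exact (iteratedFDerivWithin_of_isOpen m hU hy).symm

/-- The iterated derivatives of a `C^N` function are continuous on an open set of smoothness.
[folklore] -/
theorem continuousOn_iteratedFDeriv_of_contDiffOn {U : Set P} (hU : IsOpen U) {N : ℕ∞} {f : P → G}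
    (hf : ContDiffOn ℝ N f U) {m : ℕ} (hm : (m : ℕ∞) ≤ N) :
    ContinuousOn (iteratedFDeriv ℝ m f) U :=
  (hf.continuousOn_iteratedFDerivWithin (by exact_mod_cast hm) hU.uniqueDiffOn).congr
    fun _ hx => (iteratedFDerivWithin_of_isOpen m hU hx).symm

/-- **Uniform limits of Taylor fields.** Let `U` be open, `f n` `C^N` on `U` (`N ≤ ∞`), and
suppose that for every `m ≤ N` the iterated derivatives `D^m (f n)` converge uniformly on `U` to
`x ↦ p x m`, while `f n → g` pointwise on `U`. Then `g` has `p` as a Taylor series up to order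
`N` on `U` (Dieudonné, (8.6.3): the derivative of the limit is the limit of the derivatives,
iterated along the Taylor fields). [folklore] -/
theorem hasFTaylorSeriesUpToOn_of_tendstoUniformlyOn [l.NeBot] {U : Set P} (hU : IsOpen U)
    {N : ℕ∞} {f : ι → P → G} {g : P → G} {p : P → FormalMultilinearSeries ℝ P G}
    (hf : ∀ n, ContDiffOn ℝ N (f n) U)
    (hlim : ∀ m : ℕ, (m : ℕ∞) ≤ N →
      TendstoUniformlyOn (fun n x => iteratedFDeriv ℝ m (f n) x) (fun x => p x m) l U)
    (hg : ∀ x ∈ U, Tendsto (fun n => f n x) l (𝓝 (g x))) :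
    HasFTaylorSeriesUpToOn N g p U := by
  refine ⟨fun x hx => ?_, fun m hm x hx => ?_, fun m hm => ?_⟩
  · -- order zero: `p x 0 = g x`
    have h0 := (hlim 0 (by simp)).tendsto_at hx
    have h0' : Tendsto (fun n => (iteratedFDeriv ℝ 0 (f n) x).curry0) l (𝓝 ((p x 0).curry0)) :=
      ((ContinuousMultilinearMap.apply ℝ (fun _ : Fin 0 => P) G 0).continuous.tendsto _).comp h0
    have heq : (fun n => (iteratedFDeriv ℝ 0 (f n) x).curry0) = fun n => f n x := by
      funext n
      simp [ContinuousMultilinearMap.curry0]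
    rw [heq] at h0'
    exact tendsto_nhds_unique h0' (hg x hx)
  · -- the derivative of `p · m` is `(p x (m+1)).curryLeft`
    have hm' : ((m + 1 : ℕ) : ℕ∞) ≤ N := Order.add_one_le_of_lt (by exact_mod_cast hm)
    set e := continuousMultilinearCurryLeftEquiv ℝ (fun _ : Fin (m + 1) => P) G with he
    have hunif : TendstoUniformlyOn (fun n x => (iteratedFDeriv ℝ (m + 1) (f n) x).curryLeft)
        (fun x => (p x (m + 1)).curryLeft) l U := by
      have h := (e : (P [×(m + 1)]→L[ℝ] G) →L[ℝ] (P →L[ℝ] P [×m]→L[ℝ] G)).uniformContinuous.comp_tendstoUniformlyOn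
        (hlim (m + 1) hm')
      exact h
    have hderiv : ∀ n, ∀ y ∈ U, HasFDerivAt (fun z => iteratedFDeriv ℝ m (f n) z)
        ((iteratedFDeriv ℝ (m + 1) (f n) y).curryLeft) y :=
      fun n y hy => hasFDerivAt_iteratedFDeriv_of_contDiffOn hU (hf n) (by exact_mod_cast hm) hy
    have hpt : ∀ y ∈ U, Tendsto (fun n => iteratedFDeriv ℝ m (f n) y) l (𝓝 (p y m)) :=
      fun y hy => (hlim m (le_of_lt (by exact_mod_cast hm))).tendsto_at hy
    exact (hasFDerivAt_of_tendstoUniformlyOn hU hunif hderiv hpt hx).hasFDerivWithinAt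
  · -- continuity of the fields
    have hm' : (m : ℕ∞) ≤ N := by exact_mod_cast hm
    refine (hlim m hm').continuousOn (Frequently.of_forall fun n => ?_)
    exact continuousOn_iteratedFDeriv_of_contDiffOn hU (hf n) hm'

/-- **`C^N` is closed under uniform convergence of the derivatives of order `≤ N`**
(Dieudonné, (8.6.3), (8.12)). [folklore] -/
theorem contDiffOn_of_tendstoUniformlyOn_iteratedFDeriv [l.NeBot] {U : Set P} (hU : IsOpen U)
    {N : ℕ∞} {f : ι → P → G} {g : P → G} {p : P → FormalMultilinearSeries ℝ P G}
    (hf : ∀ n, ContDiffOn ℝ N (f n) U)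
    (hlim : ∀ m : ℕ, (m : ℕ∞) ≤ N →
      TendstoUniformlyOn (fun n x => iteratedFDeriv ℝ m (f n) x) (fun x => p x m) l U)
    (hg : ∀ x ∈ U, Tendsto (fun n => f n x) l (𝓝 (g x))) :
    ContDiffOn ℝ N g U :=
  (hasFTaylorSeriesUpToOn_of_tendstoUniformlyOn hU hf hlim hg).contDiffOn

/-- **The derivatives of the limit are the limits of the derivatives**: under the hypotheses of
`hasFTaylorSeriesUpToOn_of_tendstoUniformlyOn`, `D^m g (x) = p x m` for `m ≤ N`, `x ∈ U`.
[folklore] -/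
theorem iteratedFDeriv_eq_of_tendstoUniformlyOn [l.NeBot] {U : Set P} (hU : IsOpen U)
    {N : ℕ∞} {f : ι → P → G} {g : P → G} {p : P → FormalMultilinearSeries ℝ P G}
    (hf : ∀ n, ContDiffOn ℝ N (f n) U)
    (hlim : ∀ m : ℕ, (m : ℕ∞) ≤ N →
      TendstoUniformlyOn (fun n x => iteratedFDeriv ℝ m (f n) x) (fun x => p x m) l U)
    (hg : ∀ x ∈ U, Tendsto (fun n => f n x) l (𝓝 (g x))) {m : ℕ} (hm : (m : ℕ∞) ≤ N)
    {x : P} (hx : x ∈ U) :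
    iteratedFDeriv ℝ m g x = p x m := by
  have h := (hasFTaylorSeriesUpToOn_of_tendstoUniformlyOn hU hf hlim hg).eq_iteratedFDerivWithin_of_uniqueDiffOn
    (by exact_mod_cast hm) hU.uniqueDiffOn hx
  rw [iteratedFDerivWithin_of_isOpen m hU hx] at h
  exact h.symm

/-- **The derivatives of the limit are the uniform limits of the derivatives**:
`D^m (f n) → D^m g` uniformly on `U` for `m ≤ N`. [folklore] -/
theorem tendstoUniformlyOn_iteratedFDeriv_of_tendstoUniformlyOn [l.NeBot] {U : Set P} (hU : IsOpen U)
    {N : ℕ∞} {f : ι → P → G} {g : P → G} {p : P → FormalMultilinearSeries ℝ P G}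
    (hf : ∀ n, ContDiffOn ℝ N (f n) U)
    (hlim : ∀ m : ℕ, (m : ℕ∞) ≤ N →
      TendstoUniformlyOn (fun n x => iteratedFDeriv ℝ m (f n) x) (fun x => p x m) l U)
    (hg : ∀ x ∈ U, Tendsto (fun n => f n x) l (𝓝 (g x))) {m : ℕ} (hm : (m : ℕ∞) ≤ N) :
    TendstoUniformlyOn (fun n x => iteratedFDeriv ℝ m (f n) x) (iteratedFDeriv ℝ m g) l U := by
  refine (tendstoUniformlyOn_iff.2 fun ε hε => ?_)
  have h := tendstoUniformlyOn_iff.1 (hlim m hm) ε hε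
  filter_upwards [h] with n hn x hx
  rw [iteratedFDeriv_eq_of_tendstoUniformlyOn hU hf hlim hg hm hx]
  exact hn x hx

/-- **Uniform bounds pass to the limit**: if `‖D^m (f n) x‖ ≤ C` eventually along `l`, then
`‖D^m g x‖ ≤ C` (`m ≤ N`, `x ∈ U`). [folklore] -/
theorem norm_iteratedFDeriv_le_of_tendstoUniformlyOn [l.NeBot] {U : Set P} (hU : IsOpen U)
    {N : ℕ∞} {f : ι → P → G} {g : P → G} {p : P → FormalMultilinearSeries ℝ P G}
    (hf : ∀ n, ContDiffOn ℝ N (f n) U)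
    (hlim : ∀ m : ℕ, (m : ℕ∞) ≤ N →
      TendstoUniformlyOn (fun n x => iteratedFDeriv ℝ m (f n) x) (fun x => p x m) l U)
    (hg : ∀ x ∈ U, Tendsto (fun n => f n x) l (𝓝 (g x))) {m : ℕ} (hm : (m : ℕ∞) ≤ N)
    {x : P} (hx : x ∈ U) {C : ℝ} (hC : ∀ᶠ n in l, ‖iteratedFDeriv ℝ m (f n) x‖ ≤ C) :
    ‖iteratedFDeriv ℝ m g x‖ ≤ C := by
  rw [iteratedFDeriv_eq_of_tendstoUniformlyOn hU hf hlim hg hm hx]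
  have ht : Tendsto (fun n => ‖iteratedFDeriv ℝ m (f n) x‖) l (𝓝 ‖p x m‖) :=
    ((hlim m hm).tendsto_at hx).norm
  exact le_of_tendsto ht hC

/-! ### Cauchy form for complete targets -/

/-- **Cauchy form.** Let `G` be complete, `U` open, `f n` `C^N` on `U`, and suppose that for
every `m ≤ N` the iterated derivatives `D^m (f n)` are uniformly Cauchy on `U` (along any
nontrivial filter `l`). Then there are `g` and Taylor fields `p` with
`f n → g` and `D^m (f n) → p m` uniformly on `U` (`m ≤ N`); in particular `g` is `C^N` on `U`
with `D^m g = p m` there. [folklore] -/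
theorem exists_tendstoUniformlyOn_of_uniformCauchySeqOn_iteratedFDeriv [CompleteSpace G] [l.NeBot]
    {U : Set P} {N : ℕ∞} {f : ι → P → G}
    (hc : ∀ m : ℕ, (m : ℕ∞) ≤ N →
      UniformCauchySeqOn (fun n x => iteratedFDeriv ℝ m (f n) x) l U) :
    ∃ g : P → G, ∃ p : P → FormalMultilinearSeries ℝ P G,
      TendstoUniformlyOn f g l U ∧ (∀ x ∈ U, Tendsto (fun n => f n x) l (𝓝 (g x))) ∧
      ∀ m : ℕ, (m : ℕ∞) ≤ N →
        TendstoUniformlyOn (fun n x => iteratedFDeriv ℝ m (f n) x) (fun x => p x m) l U := by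
  classical
  -- pointwise limits of the derivative fields
  have hpt : ∀ m : ℕ, (m : ℕ∞) ≤ N → ∀ x ∈ U, ∃ q : P [×m]→L[ℝ] G,
      Tendsto (fun n => iteratedFDeriv ℝ m (f n) x) l (𝓝 q) := by
    intro m hm x hx
    exact cauchy_map_iff_exists_tendsto.1 ((hc m hm).cauchy_map hx)
  choose! q hq using hpt
  set p : P → FormalMultilinearSeries ℝ P G := fun x m => q m x with hp
  have hlim : ∀ m : ℕ, (m : ℕ∞) ≤ N →
      TendstoUniformlyOn (fun n x => iteratedFDeriv ℝ m (f n) x) (fun x => p x m) l U := by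
    intro m hm
    exact (hc m hm).tendstoUniformlyOn_of_tendsto fun x hx => hq m hm x hx
  -- the function itself is the order-zero field, uncurried
  set g : P → G := fun x => (p x 0).curry0 with hg
  have h0 := hlim 0 (by simp)
  have hfg : TendstoUniformlyOn f g l U := by
    have h := (continuousMultilinearCurryFin0 ℝ P G).toContinuousLinearEquiv.toContinuousLinearMap.uniformContinuous.comp_tendstoUniformlyOn h0
    refine h.congr (Eventually.of_forall fun n x _ => ?_)
    simp
  exact ⟨g, p, hfg, fun x hx => hfg.tendsto_at hx, hlim⟩

omit [NormedSpace ℝ G] in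
/-- **Geometric increments are uniformly Cauchy**: if `‖F (n+1) x - F n x‖ ≤ a rⁿ` on `s` with
`0 ≤ a`, `0 ≤ r < 1`, then `F` is uniformly Cauchy on `s` (the uniform form of
`cauchySeq_of_le_geometric`: the tails are bounded by `a rⁿ / (1 - r)`). [folklore] -/
theorem uniformCauchySeqOn_of_le_geometric {α : Type*} {F : ℕ → α → G} {s : Set α} {a r : ℝ}
    (ha : 0 ≤ a) (hr0 : 0 ≤ r) (hr : r < 1)
    (h : ∀ n, ∀ x ∈ s, ‖F (n + 1) x - F n x‖ ≤ a * r ^ n) :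
    UniformCauchySeqOn F atTop s := by
  -- tail bound
  have htail : ∀ x ∈ s, ∀ {n m : ℕ}, n ≤ m → dist (F n x) (F m x) ≤ a * r ^ n / (1 - r) := by
    intro x hx n m hnm
    calc dist (F n x) (F m x) ≤ ∑ k ∈ Finset.Ico n m, dist (F k x) (F (k + 1) x) :=
          dist_le_Ico_sum_dist (fun k => F k x) hnm
      _ ≤ ∑ k ∈ Finset.Ico n m, a * r ^ k := by
          refine Finset.sum_le_sum fun k _ => ?_
          rw [dist_comm, dist_eq_norm]
          exact h k x hx
      _ = a * ∑ k ∈ Finset.Ico n m, r ^ k := by rw [Finset.mul_sum]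
      _ ≤ a * (r ^ n / (1 - r)) :=
          mul_le_mul_of_nonneg_left (geom_sum_Ico_le_of_lt_one hr0 hr) ha
      _ = a * r ^ n / (1 - r) := by ring
  rw [Metric.uniformCauchySeqOn_iff]
  intro ε hε
  have h1r : 0 < 1 - r := by linarith
  have hlim : Tendsto (fun n => a * r ^ n / (1 - r)) atTop (𝓝 0) := by
    have := ((tendsto_pow_atTop_nhds_zero_of_lt_one hr0 hr).const_mul a).div_const (1 - r)
    simpa using this
  obtain ⟨N, hN⟩ := (Metric.tendsto_atTop.1 hlim) ε hε
  refine ⟨N, fun m hm n hn x hx => ?_⟩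
  have hbN : a * r ^ N / (1 - r) < ε := by
    have := hN N le_rfl
    rw [Real.dist_eq, sub_zero, abs_of_nonneg (by positivity)] at this
    exact this
  have hmono : ∀ {k : ℕ}, N ≤ k → a * r ^ k / (1 - r) ≤ a * r ^ N / (1 - r) := by
    intro k hk
    have : r ^ k ≤ r ^ N := pow_le_pow_of_le_one hr0 hr.le hk
    gcongr
  rcases le_total m n with hmn | hnm
  · calc dist (F m x) (F n x) ≤ a * r ^ m / (1 - r) := htail x hx hmn
      _ ≤ a * r ^ N / (1 - r) := hmono hm
      _ < ε := hbN
  · rw [dist_comm]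
    calc dist (F n x) (F m x) ≤ a * r ^ n / (1 - r) := htail x hx hnm
      _ ≤ a * r ^ N / (1 - r) := hmono hn
      _ < ε := hbN

end Literature.Analysis.Calculus

end
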